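import Summits.Ventures.HodgeRepro2.LevelUnitsKronecker

/-!
# Kronecker's step for a CM field, with Mathlib's complex conjugation (seat p8, B5 Remark B5.9)

`LevelUnitsKronecker.exists_pow_eq_one_of_mul_conj_eq_one` (T4-B5 Remark B5.9, Kronecker's
step) takes as a HYPOTHESIS a ring endomorphism `c` of the number field `E` that is complex
conjugation under every complex embedding.  For a CM field in Mathlib's sense (`IsCMField E`)
that hypothesis is Mathlib's `IsCMField.complexEmbedding_complexConj` for
`c = IsCMField.complexConj E`; so the step reads: an algebraic integer `u` of a CM field with
`u · ū = 1` is a root of unity (`exists_pow_eq_one_of_mul_complexConj_eq_one`), and the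
norm-one units `E¹ ∩ 𝓞_E` are torsion.  This discharges the «(CM)» clause of that remark
from Mathlib; no new mathematics.
-/

namespace Summit.Ventures.HodgeRepro2.LevelUnitsKroneckerCM

open Summit.Ventures.HodgeRepro2.LevelPositivity NumberField

variable (E : Type*) [Field E] [NumberField E] [IsCMField E]

/-- Mathlib's complex conjugation of a CM field, as a ring endomorphism. -/
noncomputable def conjHom : E →+* E :=
  (IsCMField.complexConj E).toAlgHom.toRingHom

/-- `conjHom` is `complexConj`. -/
@[simp] theorem conjHom_apply (x : E) : conjHom E x = IsCMField.complexConj E x :=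
  rfl

/-- Mathlib's complex conjugation of a CM field is complex conjugation under every embedding. -/
theorem complexEmbedding_conjHom (φ : E →+* ℂ) (x : E) :
    φ (conjHom E x) = (starRingEnd ℂ) (φ x) :=
  IsCMField.complexEmbedding_complexConj E φ x

variable {E}

/-- Kronecker's step for a CM field: an algebraic integer `u` with `u · ū = 1` is a root of
unity. -/
theorem exists_pow_eq_one_of_mul_complexConj_eq_one {u : E} (hu : IsIntegral ℤ u)
    (huc : u * IsCMField.complexConj E u = 1) : ∃ n, 0 < n ∧ u ^ n = 1 :=
  exists_pow_eq_one_of_mul_conj_eq_one (conjHom E) (complexEmbedding_conjHom E) hu huc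

/-- The norm-one condition `u · ū = 1` for a CM field is `|φ u| = 1` at every embedding. -/
theorem norm_embedding_eq_one_of_mul_complexConj_eq_one {u : E}
    (huc : u * IsCMField.complexConj E u = 1) (φ : E →+* ℂ) : ‖φ u‖ = 1 := by
  have h : φ u * (starRingEnd ℂ) (φ u) = 1 := by
    rw [← IsCMField.complexEmbedding_complexConj E φ u, ← map_mul, huc, map_one]
  rw [Complex.mul_conj, Complex.normSq_eq_norm_sq, ← Complex.ofReal_one, Complex.ofReal_inj] at h
  exact (pow_eq_one_iff_of_nonneg (norm_nonneg _) two_ne_zero).1 h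

/-- The same conclusion read through Mathlib's `pow_eq_one_of_norm_eq_one` directly. -/
theorem exists_pow_eq_one_of_mul_complexConj_eq_one' {u : E} (hu : IsIntegral ℤ u)
    (huc : u * IsCMField.complexConj E u = 1) : ∃ n, ∃ _ : 0 < n, u ^ n = 1 :=
  Embeddings.pow_eq_one_of_norm_eq_one E ℂ hu
    (fun φ => norm_embedding_eq_one_of_mul_complexConj_eq_one huc φ)

end Summit.Ventures.HodgeRepro2.LevelUnitsKroneckerCM
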